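import Mathlib
import HarnessLib
import Literature.Analysis.FluidPDE.TypeIAncientMild
import Literature.Analysis.FluidPDE.AxisymmetricEuler
import Literature.Analysis.FluidPDE.VectorCalculus
import Literature.Analysis.FluidPDE.WeakSolution

/-!
# Sketch — crux-ideate, crux `AxisymEndLiouville` (stmt-NavierStokesRegularity-14061), round 1, ideator 3

First lemmas of the two idea cards `axis-absorbed-similarity-diffusion` and
`lyapunov-weighted-extremal-swirl`, stated over existing declarations (`def … : Prop`, no proofs),
plus the shared transfer (`SwirlVanishes`, `NoSwirlEndgame`, `AxisNormalForm`) and the kernel-checked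
composition `axisymEndLiouville_of` showing that the three transfer statements decide the crux
(the crux is restated verbatim as `Crux`; the farm's build of the route module may lag the ledger).

Notation. `A_C` = `Literature.Analysis.FluidPDE.IsTypeIAncientMild C u` (smooth on `t<0`, div-free,
KNSS–Oseen mild between all `s<t<0`, `‖u t x‖ ≤ C/√(−t)`). `swirl v x = x₀v₁ − x₁v₀ = r v_θ`
(junk-free, vanishes on the axis), `cylRadius x = r`, `eR x = e_r`, `IsAxisymmetric`,
`IsAxisymmetricScalar` (all `Literature.Analysis.FluidPDE`, axis = the `x 2`-axis).
-/

noncomputable section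

namespace Summit.NavierStokesRegularity.NavierStokesRegularity.Cruxes.AxisymEndLiouville.SketchIdeator3

open MeasureTheory Set
open scoped Laplacian

open Literature.Analysis.FluidPDE

local notation "ℝ³" => EuclideanSpace ℝ (Fin 3)

/-! ## The crux, verbatim -/

/-- The crux `SymmetryModuliCount.AxisymEndLiouville`, restated verbatim (route rev 9). -/
def Crux : Prop :=
  ∀ (C : ℝ) (u : ℝ → ℝ³ → ℝ³), IsTypeIAncientMild C u →
    ∀ (c : ℝ³) (A : ℝ³ →L[ℝ] ℝ³) (θ : ℝ), (∀ x, inner ℝ (A x) x = 0) → A ≠ 0 → θ ≤ 0 →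
      (∀ t < θ, ∀ x, fderiv ℝ (u t) x (A (x - c)) - A (u t x) = 0) → ∀ t < θ, ∀ x, u t x = 0

/-! ## Shared transfer: crux ⇐ normal form + swirl vanishing + no-swirl endgame -/

/-- **T1 (normal form; kinematics + covariance of the Oseen class, sibling `stub_axisNormalForm`).**
An element of `A_C` annihilated on the end `t < θ` by the rotations about the axis `c + ker A`
is conjugate, by a rigid motion of `ℝ³` and the backward time shift by `−θ`, to an element of the
SAME class `A_C` which is axisymmetric about the `x 2`-axis on the whole past `t < 0`; and the
conjugation transports vanishing back. Stated as the reduction it provides. -/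
def AxisNormalForm : Prop :=
  (∀ (C : ℝ) (w : ℝ → ℝ³ → ℝ³), IsTypeIAncientMild C w → (∀ t < 0, IsAxisymmetric (w t)) →
      ∀ t < 0, ∀ x, w t x = 0) →
    Crux

/-- **T2 = C⁺ (SWIRL VANISHES): every axisymmetric element of `A_C` is swirl-free.** This is the
statement both levers prove; it is LINEAR in `Γ = swirl (u t)` once `u` is frozen as a coefficient. -/
def SwirlVanishes : Prop :=
  ∀ (C : ℝ) (u : ℝ → ℝ³ → ℝ³), IsTypeIAncientMild C u → (∀ t < 0, IsAxisymmetric (u t)) →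
    ∀ t < 0, ∀ x, swirl (u t) x = 0

/-- **T3 (no-swirl endgame; KNOWN).** A swirl-free axisymmetric element of `A_C` vanishes: on every
window `(−∞, −δ)` it is a bounded ancient mild solution (`IsTypeIAncientMild.isBoundedAncientMildSolution_sub`),
KNSS 2009 Thm 5.2 (PROVED tree theorem `KNSS2009_liouville_axisymmetric_no_swirl_holds` /
`knss_axisymmetric_no_swirl'`) makes its slices constant, and the gauge kills constant slices
(`IsTypeIAncientMild.eq_zero_of_slice_const`). In the Type-I class there is also a three-line proof:
`Ω = ω_θ/r` solves `∂ₜΩ + b·∇Ω = Δ₅Ω`, `sup_x |Ω(t)| ≤ ‖∇ω(t)‖_∞ ≤ C₂(−t)^{-3/2} → 0` as `t → −∞`,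
weak maximum principle. -/
def NoSwirlEndgame : Prop :=
  ∀ (C : ℝ) (u : ℝ → ℝ³ → ℝ³), IsTypeIAncientMild C u → (∀ t < 0, IsAxisymmetric (u t)) →
    (∀ t < 0, HasNoSwirl (u t)) → ∀ t < 0, ∀ x, u t x = 0

/-- **The transfer is a proof**: T1 ∧ T2 ∧ T3 ⇒ the crux (pure logic). -/
theorem axisymEndLiouville_of (h1 : AxisNormalForm) (h2 : SwirlVanishes) (h3 : NoSwirlEndgame) :
    Crux :=
  h1 fun C w hw hax => h3 C w hw hax fun t ht x => h2 C w hw hax t ht x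

/-! ## Card 1 — axis-absorbed similarity diffusion: the LINEAR Liouville theorem behind T2 -/

/-- **L1 (axis-killed swirl Liouville; the lever of card 1, linear and `u`-free).** Let `b` be a
continuous drift on `(−∞,0) × ℝ³` with the temporal Type-I bound `‖b t x‖ ≤ C/√(−t)` (nothing else:
no divergence condition, no equation for `b`). Let `f` be smooth on the open slab, an axisymmetric
scalar vanishing on the axis, with the scale-invariant linear growth `|f t x| ≤ C r/√(−t)`, solving
the swirl equation (KNSS (5.10) = tree `swirl_transport` shape) `∂ₜf + b·∇f = Δf − (2/r)∂ᵣf` off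
the axis. Then `f ≡ 0`. (Proof on the card: in backward similarity variables the drift becomes
BOUNDED plus the confining Ornstein–Uhlenbeck field `y/2`; the associated diffusion is positive
recurrent and is absorbed at the axis almost surely, so the killed semigroup annihilates every
eternal solution of linear growth.) Applied to `f = swirl ∘ u`, `b = u` it gives `SwirlVanishes`. -/
def AxisKilledSwirlLiouville : Prop :=
  ∀ (C : ℝ) (b : ℝ → ℝ³ → ℝ³) (f : ℝ → ℝ³ → ℝ),
    ContinuousOn (Function.uncurry b) (Iio 0 ×ˢ univ) →
    ContDiffOn ℝ (⊤ : ℕ∞) (Function.uncurry f) (Iio 0 ×ˢ univ) →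
    (∀ t < 0, ∀ x, ‖b t x‖ ≤ C / Real.sqrt (-t)) →
    (∀ t < 0, IsAxisymmetricScalar (f t)) →
    (∀ t < 0, ∀ x, cylRadius x = 0 → f t x = 0) →
    (∀ t < 0, ∀ x, |f t x| ≤ C * cylRadius x / Real.sqrt (-t)) →
    (∀ t < 0, ∀ x, cylRadius x ≠ 0 →
      timeDeriv f t x + convect (b t) (f t) x =
        (Δ (f t)) x - 2 / cylRadius x * partialDeriv (eR x) (f t) x) →
    ∀ t < 0, ∀ x, f t x = 0

/-- **L1 ⇒ T2** is bookkeeping in the class: `f := fun t => swirl (u t)` is smooth, axisymmetric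
(`IsAxisymmetric.isAxisymmetricScalar_swirl`), vanishes on the axis (`swirl_eq_zero_of_cylRadius_eq_zero`),
`|swirl (u t) x| ≤ r‖u t x‖ ≤ C r/√(−t)` (`abs_swirl_le_cylRadius_mul_norm` + Type I), and solves the
swirl equation with `b = u` on every window by `swirl_transport_holds` for the classical pair of
`IsTypeIAncientMild.exists_isClassicalNSSolutionOn_Ioo` (pressure axisymmetric:
`IsClassicalNSSolutionOn.isAxisymmetricScalar_pressure`). Recorded as the implication to be proved. -/
def SwirlVanishes_of_axisKilled : Prop :=
  AxisKilledSwirlLiouville → SwirlVanishes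

/-- **L1′ (the universal barrier = worst-case survival function; PDE rendering of the lever).**
For every `C ≥ 0` there is ONE function `h : ℝ → ℝ → ℝ` of `(σ, ρ)` — the probability that the
radial similarity diffusion `dρ = (−1/ρ − ρ/2 + C) dσ + √2 dW` (worst-case outward control `C`)
started at `ρ` has not hit `0` by time `σ` — with: `h(σ, 0) = 0`, `0 ≤ h ≤ 1`, `h(0, ρ) = 1` for
`ρ > 0`, `h` non-increasing in `σ`, solving `∂_σ h = ∂²_ρ h + (−1/ρ − ρ/2 + C) ∂_ρ h` on `σ > 0 < ρ`,
and `h(σ, ρ) → 0` as `σ → ∞` for every `ρ`. (Its decay rate is the principal Dirichlet eigenvalue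
`λ₁(C) > 0` of the Sturm–Liouville operator, self-adjoint in `L²(ρ⁻¹e^{−ρ²/4+Cρ}dρ)`; kit toy on the
card.) Comparison in similarity variables gives `|G(s, y)| ≤ (sup |G|)·h(σ, ρ(y))` for every `σ`, hence L1. -/
def UniversalAxisBarrier : Prop :=
  ∀ C : ℝ, 0 ≤ C → ∃ h : ℝ → ℝ → ℝ,
    (∀ σ, 0 ≤ σ → h σ 0 = 0) ∧
    (∀ σ ρ, 0 ≤ σ → 0 ≤ ρ → 0 ≤ h σ ρ ∧ h σ ρ ≤ 1) ∧
    (∀ ρ, 0 < ρ → h 0 ρ = 1) ∧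
    (∀ ρ, 0 ≤ ρ → Antitone fun σ => h σ ρ) ∧
    ContDiffOn ℝ 2 (Function.uncurry h) (Ioi 0 ×ˢ Ioi 0) ∧
    (∀ σ ρ, 0 < σ → 0 < ρ →
      deriv (fun σ' => h σ' ρ) σ =
        deriv (fun ρ' => deriv (fun ρ'' => h σ ρ'') ρ') ρ + (-1 / ρ - ρ / 2 + C) * deriv (fun ρ' => h σ ρ') ρ) ∧
    (∀ ρ, 0 ≤ ρ → Filter.Tendsto (fun σ => h σ ρ) Filter.atTop (nhds 0))

/-! ## Card 2 — Lyapunov-weighted KNSS extremal principle -/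

/-- **L2 (the Lyapunov weight; the lever of card 2, an explicit 1-D ODE inequality).** For every
`C ≥ 0` there is a `C²` weight `k` with `k 0 = 0`, slope pinched `κ ≤ k' ≤ 1` (`κ = κ(C) > 0`, in
fact `κ = e^{−2C²}` works), which is a SUPERSOLUTION of the radial part of the similarity swirl
operator for EVERY radial drift of size `≤ C`:
`k'' − k'/ρ − (ρ/2) k' − β k' ≤ 0` for all `ρ > 0`, `|β| ≤ C`.
(Construction: `(log k')' ≤ 1/ρ + ρ/2 − C`; `k' = 1` on `ρ ≤ 1/C`, decrease `log k'` at rate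
`(C − 1/ρ − ρ/2)₊` across the band `(1/C, 2C)`, constant afterwards.) Consequence (card): in
similarity variables `Ψ = G/k(ρ)` is a BOUNDED subsolution-type quantity (`∂_sΨ = ΔΨ − Ṽ·∇Ψ + cΨ`,
`c = (Lk)/k ≤ 0`, `Ṽ` bounded near the axis because `k ≈ ρ` cancels `2/ρ`) vanishing at the axis and,
with the sibling barrier `|Γ| ≤ 2C²` or the receding-axis lemma, negligible at parabolic infinity. -/
def LyapunovWeight : Prop :=
  ∀ C : ℝ, 0 ≤ C → ∃ (k : ℝ → ℝ) (κ : ℝ), 0 < κ ∧ ContDiff ℝ 2 k ∧ k 0 = 0 ∧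
    (∀ ρ, 0 ≤ ρ → κ ≤ deriv k ρ ∧ deriv k ρ ≤ 1) ∧
    (∀ ρ, 0 < ρ → ∀ β : ℝ, |β| ≤ C →
      deriv (deriv k) ρ - deriv k ρ / ρ - ρ / 2 * deriv k ρ - β * deriv k ρ ≤ 0)

/-- **L2′ (KNSS extremal principle for the weighted swirl, stated in physical variables).** With a
weight `k` as in L2, the scale-invariant weighted swirl `Γ(t,x)/k(r/√(−t))` of axisymmetric elements
of `A_C` has supremum `≤ 0` over the whole class and all points — the KNSS 2009 Thm 5.3 architecture
(compactness of the class modulo axis scalings / `x 2`-translations, extremal element, strong maximum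
principle for a subsolution, contradiction at the axis where the quantity vanishes), with the
far-field case empty. With the reflection `x 1 ↦ −x 1` (class-covariant, `Γ ↦ −Γ`) it gives T2. -/
def WeightedSwirlSupNonpos : Prop :=
  ∀ (C : ℝ) (k : ℝ → ℝ) (κ : ℝ), 0 < κ → ContDiff ℝ 2 k → k 0 = 0 →
    (∀ ρ, 0 ≤ ρ → κ ≤ deriv k ρ ∧ deriv k ρ ≤ 1) →
    (∀ ρ, 0 < ρ → ∀ β : ℝ, |β| ≤ C →
      deriv (deriv k) ρ - deriv k ρ / ρ - ρ / 2 * deriv k ρ - β * deriv k ρ ≤ 0) →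
    ∀ (u : ℝ → ℝ³ → ℝ³), IsTypeIAncientMild C u → (∀ t < 0, IsAxisymmetric (u t)) →
      ∀ t < 0, ∀ x, cylRadius x ≠ 0 → swirl (u t) x / k (cylRadius x / Real.sqrt (-t)) ≤ 0

/-- **L2 ∧ L2′ ⇒ T2** (reflection symmetry + the axis values; bookkeeping). Recorded as the implication. -/
def SwirlVanishes_of_weighted : Prop :=
  LyapunovWeight → WeightedSwirlSupNonpos → SwirlVanishes

/-! ## The common first step of both cards: the swirl equation in backward similarity variables -/

/-- **S (similarity form of the swirl equation).** For an axisymmetric `u ∈ A_C` put `t = −e^{−s}`,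
`x = e^{−s/2} y`, `G(s, y) := swirl (u t) x` (the swirl is dimensionless) and `B(s, y) := e^{−s/2} u t x`
(`‖B‖ ≤ C`: the Type-I class becomes the BOUNDED-drift class). Then off the axis
`∂_s G = ΔG − D G[ y/2 + B + (2/ρ) e_ρ ]`, `ρ = cylRadius y` — a drift–diffusion whose unbounded
part `y/2` is the confining Ornstein–Uhlenbeck field of backward self-similarity. (Chain rule from
`swirl_transport_holds`; `e_θ`-components of `B` do not act on the axisymmetric scalar `G`.) -/
def SimilaritySwirlEquation : Prop :=
  ∀ (C : ℝ) (u : ℝ → ℝ³ → ℝ³), IsTypeIAncientMild C u → (∀ t < 0, IsAxisymmetric (u t)) →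
    ∀ (s : ℝ) (y : ℝ³), cylRadius y ≠ 0 →
      deriv (fun s' => swirl (u (-Real.exp (-s'))) (Real.exp (-s' / 2) • y)) s =
        (Δ (fun y' => swirl (u (-Real.exp (-s))) (Real.exp (-s / 2) • y'))) y -
          fderiv ℝ (fun y' => swirl (u (-Real.exp (-s))) (Real.exp (-s / 2) • y')) y
            ((1 / 2 : ℝ) • y + Real.exp (-s / 2) • u (-Real.exp (-s)) (Real.exp (-s / 2) • y) +
              (2 / cylRadius y) • eR y)

end Summit.NavierStokesRegularity.NavierStokesRegularity.Cruxes.AxisymEndLiouville.SketchIdeator3
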